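import Mathlib.Analysis.SpecialFunctions.Pow.Real
import Mathlib.Analysis.SpecialFunctions.Sqrt
import Mathlib.Tactic.Linarith
import Mathlib.Tactic.FieldSimp
import Mathlib.Tactic.Positivity
import HarnessLib

/-!
# Functional mining (K1-Q1/V, dictionary §14b): the TRANSLATION METHOD with the quadratic Betchov null Lagrangian returns exactly Hölder's `2/√3` — computational core

Search for candidate a priori estimates; no regularity claim.

Cell `pub-nsfunc`, dict seat (gen 11), STAGED for the prove seat (target tree path
`Summits/NavierStokesRegularity/FunctionalMining/NoGo/StretchingTranslationBarrier.lean`; Mathlib-only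
imports; LOW priority). Typed question K1-Q1/V (`HOME/DICTIONARY.md` §14b, observation POLY-NULL).

CONTEXT (dictionary §14b, (R)). With `σ = ∫ωᵀSω`, `ℰ = ½∫|ω|²` on `𝕋³`, the static bound
`σ ≤ θ‖ω‖_∞ℰ` is equivalent to `∫ P_θ(∇v) ≤ 0` for the constrained state integrand
`P_θ(A) = ωᵀSω − (θ/2)|ω|²` on `{tr A = 0, |ω| ≤ 1}`. The TRANSLATION (polyconcave) method bounds
`P_θ` POINTWISE by a null Lagrangian `N` (`∫N(∇v) = 0` for periodic div-free `v`); with the quadratic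
isotropic one, `N_α(A) = α(|S|² − ½|ω|²)` (Betchov's first relation), the best constant it can certify is
`inf_α (α + 1/(3α)) = 2/√3`, i.e. exactly Hölder's constant (`StretchingSupHolder`). This file proves the
two scalar facts behind that sentence, in coordinates (no matrices, no integrals):
* `translation_forces (hα : 0 < α) (h : testLHS α θ ≤ testRHS α)`: if the pointwise inequality
  `ωᵀSω − (θ/2)|ω|² ≤ α(|S|_F² − ½|ω|²)` holds at the single explicit state `ω = e₁`,
  `S = diag(1/(3α), −1/(6α), −1/(6α))` (symmetric, trace-free), then `α + 1/(3α) ≤ θ` (no `Prop` is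
  defined: the tested inequality is the displayed hypothesis `h` between two real numbers);
* `two_div_sqrt_three_le (hα : 0 < α)`: `2/√3 ≤ α + 1/(3α)`;
* `translation_floor`: the combination — any `θ` certified this way satisfies `2/√3 ≤ θ`.

HONEST SIZE. Elementary algebra recording WHY a pointwise-in-state argument with the quadratic null
Lagrangian cannot produce a sub-Hölder constant; the dictionary's full statement POLY-NULL (all classical
null Lagrangians of degree ≤ 3, via isotropic averaging and the `ω = 0` slice) is a ONE-PARTY paper
observation and is NOT asserted here. Not a bound on `C⋆`; nothing about Navier–Stokes solutions.
-/

noncomputable section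

namespace Summit.NavierStokesRegularity.FunctionalMining

namespace TranslationBarrier

/-- The quadratic form `ωᵀSω` for a symmetric `S` given by its six entries and `ω ∈ ℝ³`, in
coordinates. [ours; bookkeeping] -/
def quadForm (s11 s22 s33 s12 s13 s23 w1 w2 w3 : ℝ) : ℝ :=
  s11 * w1 ^ 2 + s22 * w2 ^ 2 + s33 * w3 ^ 2 + 2 * (s12 * w1 * w2 + s13 * w1 * w3 + s23 * w2 * w3)

/-- The Frobenius norm squared `|S|_F²` of a symmetric `S` in coordinates. [ours; bookkeeping] -/
def frobSq (s11 s22 s33 s12 s13 s23 : ℝ) : ℝ :=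
  s11 ^ 2 + s22 ^ 2 + s33 ^ 2 + 2 * (s12 ^ 2 + s13 ^ 2 + s23 ^ 2)

/-- The LEFT side of the translation inequality at the test state `ω = e₁`,
`S_α = diag(1/(3α), −1/(6α), −1/(6α))`: `ωᵀSω − (θ/2)|ω|²`. [ours; bookkeeping] -/
def testLHS (α θ : ℝ) : ℝ :=
  quadForm (1 / (3 * α)) (-(1 / (6 * α))) (-(1 / (6 * α))) 0 0 0 1 0 0 - θ / 2 * (1 ^ 2 + 0 ^ 2 + 0 ^ 2)

/-- The RIGHT side at the test state: the quadratic Betchov null Lagrangian `α(|S|_F² − ½|ω|²)`.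
(Any pointwise certificate `P_θ ≤ α(|S|² − ½|ω|²)` on the whole admissible set `{tr A = 0, |ω| ≤ 1}`
gives `testLHS α θ ≤ testRHS α`; that inequality is the hypothesis `h` below — no proposition is defined.)
[ours; bookkeeping] -/
def testRHS (α : ℝ) : ℝ :=
  α * (frobSq (1 / (3 * α)) (-(1 / (6 * α))) (-(1 / (6 * α))) 0 0 0 - (1 ^ 2 + 0 ^ 2 + 0 ^ 2) / 2)

/-- The test state is trace-free. [ours; sanity] -/
theorem test_traceFree (α : ℝ) : 1 / (3 * α) + (-(1 / (6 * α))) + (-(1 / (6 * α))) = 0 := by ring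

/-- **The translation method forces `θ ≥ α + 1/(3α)`.** Search for candidate a priori estimates; no
regularity claim. [ours; elementary] -/
theorem translation_forces {α θ : ℝ} (hα : 0 < α) (h : testLHS α θ ≤ testRHS α) :
    α + 1 / (3 * α) ≤ θ := by
  unfold testLHS testRHS quadForm frobSq at h
  have hα3 : (0 : ℝ) < 3 * α := by positivity
  have hα6 : (0 : ℝ) < 6 * α := by positivity
  have key : 1 / (3 * α) - θ / 2 ≤ 1 / (6 * α) - α / 2 := by
    have e1 : α * ((1 / (3 * α)) ^ 2 + (-(1 / (6 * α))) ^ 2 + (-(1 / (6 * α))) ^ 2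
        + 2 * ((0:ℝ) ^ 2 + 0 ^ 2 + 0 ^ 2) - ((1:ℝ) ^ 2 + 0 ^ 2 + 0 ^ 2) / 2) = 1 / (6 * α) - α / 2 := by
      field_simp
      ring
    nlinarith [e1, h]
  have e2 : 1 / (3 * α) - 1 / (6 * α) = 1 / (6 * α) := by
    field_simp
    ring
  have e3 : α + 1 / (3 * α) = 2 * (1 / (6 * α) + α / 2) := by
    field_simp
    ring
  rw [e3]
  linarith [key, e2]

/-- `2/√3 ≤ α + 1/(3α)` for `α > 0` (AM–GM; equality at `α = 1/√3`). [ours; elementary] -/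
theorem two_div_sqrt_three_le {α : ℝ} (hα : 0 < α) : 2 / Real.sqrt 3 ≤ α + 1 / (3 * α) := by
  have hs : 0 < Real.sqrt 3 := Real.sqrt_pos.mpr (by norm_num)
  have hs2 : Real.sqrt 3 ^ 2 = 3 := Real.sq_sqrt (by norm_num)
  rw [div_le_iff₀ hs]
  have hα3 : (0 : ℝ) < 3 * α := by positivity
  have expand : (α + 1 / (3 * α)) * Real.sqrt 3 = α * Real.sqrt 3 + Real.sqrt 3 / (3 * α) := by
    field_simp
  rw [expand]
  -- (α√3 − 1)² ≥ 0  ⇒  3α² + 1 ≥ 2α√3  ⇒  α√3 + √3/(3α) ≥ 2  (using √3·√3 = 3)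
  have h3 : Real.sqrt 3 / (3 * α) = 1 / (Real.sqrt 3 * α) := by
    rw [div_eq_div_iff (ne_of_gt hα3) (ne_of_gt (by positivity))]
    nlinarith [hs2]
  rw [h3]
  have hpos : 0 < Real.sqrt 3 * α := by positivity
  have hsq : 0 ≤ (α * Real.sqrt 3 - 1) ^ 2 := sq_nonneg _
  have : 2 ≤ α * Real.sqrt 3 + 1 / (Real.sqrt 3 * α) := by
    rw [show α * Real.sqrt 3 + 1 / (Real.sqrt 3 * α)
        = ((α * Real.sqrt 3) ^ 2 + 1) / (Real.sqrt 3 * α) by field_simp]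
    rw [le_div_iff₀ hpos]
    nlinarith [hsq, hs2]
  exact this

/-- **The floor of the quadratic translation method is Hölder's `2/√3`.** Search for candidate a priori
estimates; no regularity claim. [ours; elementary] -/
theorem translation_floor {α θ : ℝ} (hα : 0 < α) (h : testLHS α θ ≤ testRHS α) :
    2 / Real.sqrt 3 ≤ θ :=
  (two_div_sqrt_three_le hα).trans (translation_forces hα h)

/-- Conversely the method DOES certify `θ = α + 1/(3α)` at the test state (tightness of the core; the
pointwise inequality on the whole admissible set at `α = 1/√3`, `θ = 2/√3` is the Hölder proof itself and
is not restated here). [ours; sanity] -/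
theorem translation_self {α : ℝ} (hα : 0 < α) : testLHS α (α + 1 / (3 * α)) ≤ testRHS α := by
  unfold testLHS testRHS quadForm frobSq
  have hα' : α ≠ 0 := ne_of_gt hα
  apply le_of_eq
  field_simp
  ring

/-- Unconditional instance: at `α = 1` the method certifies exactly `θ = 4/3` (equality). [ours; sanity] -/
theorem translation_one : testLHS 1 (4 / 3) = testRHS 1 := by
  unfold testLHS testRHS quadForm frobSq
  norm_num

end TranslationBarrier

end Summit.NavierStokesRegularity.FunctionalMining

end
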